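import Mathlib.NumberTheory.LSeries.PrimesInAP
import Mathlib.NumberTheory.LegendreSymbol.JacobiSymbol
import Literature.NumberTheory.EllipticCurves.IsogenyFaltingsTraceDensityProofs
import Literature.NumberTheory.EllipticCurves.HasseManin
import Literature.AlgebraicGeometry.Motives.FaltingsECSemisimpleNumberFieldProofs
import HarnessLib

/-!
# `V_ℓ E` is irreducible when one Frobenius has irreducible characteristic polynomial mod `ℓ`

Theorem-only file (no definitions, no instances) on the rational Tate module
`V_ℓ E = ℚ_ℓ ⊗ T_ℓ E` of an elliptic curve (`WeierstrassCurve.rationalGaloisRepTate`,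
`Literature.NumberTheory.EllipticCurves.TateModule`), recording the classical elementary
irreducibility criterion and its consequence over `ℚ`:

> if some `σ ∈ Γ_K` acts on `T_ℓ E ≅ ℤ_ℓ²` with characteristic polynomial
> `X² - tr(σ) X + det(σ)` having no root modulo `ℓ`, then `V_ℓ E` has no `Γ_K`-stable line, so
> it is an irreducible — in particular semisimple — `ℚ_ℓ[Γ_K]`-module. For `E / ℚ` and a prime
> `p` of good reduction, `a_p² - 4p < 0` (Hasse), so by Dirichlet's theorem there are infinitely
> many primes `ℓ` (those `≡ -1 (mod 4(4p - a_p²))`, a Jacobi-symbol computation) modulo which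
> `a_p² - 4p` is not a square; for such `ℓ ≠ p` the characteristic polynomial `X² - a_p X + p`
> of `Frob_p` on `T_ℓ E` has no root modulo `ℓ`, hence `V_ℓ E` is irreducible.

So for **every** elliptic curve over `ℚ` (with or without complex multiplication) `V_ℓ E` is an
irreducible `Γ_ℚ`-module for all primes `ℓ` in an explicit arithmetic progression, by an
argument using neither Shafarevich's nor Siegel's theorem (through which the tree proves
Faltings' Satz 3, the semisimplicity of `V_ℓ E` for all `ℓ`:
`isSemisimpleRepresentation_rationalGaloisRepTate_holds`, `FaltingsECSemisimpleHoldsProofs`; cf.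
Serre, *Abelian ℓ-adic representations* (1968), IV.2.1–2.2, irreducibility for non-CM curves via
Shafarevich). Inputs, all theorems of the tree or of Mathlib: Hasse's bound
(`Literature.NumberTheory.EllipticCurves.HasseManin.abs_card_sub_le`, Manin's proof; Silverman,
*AEC*, Thm. V.1.1), Dirichlet's theorem (`Nat.forall_exists_prime_gt_and_eq_mod`), the Jacobi
symbol (`jacobiSym.mod_right`), trace and determinant of Frobenius on `T_ℓ E` (Silverman C.21
Remark 21.3; `trace/det_galoisRepTate_frobenius_of_hasGoodReductionAt_holds`), the primitive
vector of a stable line (`Literature.AlgebraicGeometry.Motives.exists_primitive_of_stable_line`)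
and Cayley–Hamilton for `2 × 2` matrices (`Matrix.sq_eq_trace_smul_sub_det_fin_two`).

## Contents (all proved)

* `FrobeniusIrreducible.jacobiSym_neg_natCast_eq_neg_one`,
  `FrobeniusIrreducible.exists_prime_gt_not_isSquare`: for `D < 0` and every `N` there is a
  prime `ℓ > N` with `D` a non-square modulo `ℓ`;
  `FrobeniusIrreducible.ne_zero_of_not_isSquare_discr`: then `X² - aX + p` (`a² - 4p = D`) has
  no root.
* `WeierstrassCurve.exists_root_of_stable_line` (any field `K`, `ℓ ≠ char K`): a `Γ_K`-stable
  line of `V_ℓ E` yields, for every `σ ∈ Γ_K`, a root in `ℤ_ℓ` of `X² - tr(σ) X + det(σ)`;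
  `WeierstrassCurve.finrank_ne_one_of_stable_of_no_root`,
  `WeierstrassCurve.isIrreducible_rationalGaloisRepTate_of_finrank_ne_one` (no stable line ⇒
  `Representation.IsIrreducible`; semisimplicity `Representation.IsSemisimpleRepresentation` then
  follows by `inferInstance` from Mathlib's `IsSimpleOrder.instComplementedLattice`);
  `WeierstrassCurve.isIrreducible_rationalGaloisRepTate_of_frobenius` (number field `K`, good
  place `v ∤ ℓ`, `X² - a_v X + q_v` without root modulo `ℓ`).
* `WeierstrassCurve.frobeniusTraceAt_sq_lt_four_mul` (`E / ℚ`, good `v` over `p`): `a_v² < 4p`;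
  `WeierstrassCurve.exists_prime_gt_forall_isIrreducible` (the auxiliary primes for given
  `(p, a_p)`); **`WeierstrassCurve.exists_prime_gt_isIrreducible_rationalGaloisRepTate`**: for
  `E / ℚ` and every `N` a prime `ℓ > N` with `V_ℓ E` irreducible.

## References

* [SilvermanAEC2009] J. H. Silverman, *The Arithmetic of Elliptic Curves*, 2nd ed., Thm. V.1.1
  (Hasse), III.§7, C.21 Remark 21.3.
* J.-P. Serre, *Abelian ℓ-adic representations and elliptic curves* (1968), IV.2.1–2.2.
* [Faltings1983Endlichkeit] G. Faltings, Invent. Math. 73 (1983), §5 Satz 3 (context).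

## Design

Pure theorems; `noncomputable section`; the arithmetic lemmas live in the auxiliary namespace
`Literature.NumberTheory.EllipticCurves.FrobeniusIrreducible`, the rest are deliberate
dot-notation extensions of Mathlib's `WeierstrassCurve` namespace next to the Tate-module API they
concern. The general part is stated over a field `K : Type u` with `(hℓ : (ℓ : K) ≠ 0)` as in
`FaltingsECSemisimpleNumberFieldProofs`; irreducibility is Mathlib's
`Representation.IsIrreducible` (`IsSimpleOrder` of the subrepresentation lattice), which yields
`Representation.IsSemisimpleRepresentation` (`ComplementedLattice`) by Mathlib's instance for
simple orders (`IsSimpleOrder.instComplementedLattice`; no separate restatement is kept here).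
-/

noncomputable section

open scoped NumberField NumberTheorySymbols
open IsDedekindDomain Field Literature.NumberTheory.EllipticCurves
  Literature.NumberTheory.GaloisRepresentations Literature.AlgebraicGeometry.Motives
  Literature.RepresentationTheory.Semisimple

universe u

/-! ## Arithmetic: primes modulo which a negative integer is not a square -/

namespace Literature.NumberTheory.EllipticCurves.FrobeniusIrreducible

/-- For `m ≥ 1` the Jacobi symbol `J(-m | 4m - 1)` is `-1`: `J(-1 | 4m - 1) = χ₄(4m - 1) = -1`
and `J(m | 4m - 1) = J(4 | 4m - 1) J(m | 4m - 1) = J(4m | 4m - 1) = J(1 | 4m - 1) = 1`.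
[folklore] -/
theorem jacobiSym_neg_natCast_eq_neg_one {m : ℕ} (hm : 0 < m) :
    J(-(m : ℤ) | 4 * m - 1) = -1 := by
  obtain ⟨k, rfl⟩ : ∃ k, m = k + 1 := ⟨m - 1, by omega⟩
  have hb : 4 * (k + 1) - 1 = 4 * k + 3 := by omega
  rw [hb]
  have hodd : Odd (4 * k + 3) := ⟨2 * k + 1, by ring⟩
  -- `J(4 | 4k+3) = 1`
  have h4 : J((4 : ℤ) | 4 * k + 3) = 1 := by
    rw [show (4 : ℤ) = 2 ^ 2 by norm_num]
    refine jacobiSym.sq_one' (Int.isCoprime_iff_gcd_eq_one.mp ?_)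
    exact ⟨-(2 * k + 1 : ℤ), 1, by push_cast; ring⟩
  -- `J(4(k+1) | 4k+3) = J(1 | 4k+3) = 1`
  have hprod : J((4 * ((k + 1 : ℕ) : ℤ)) | 4 * k + 3) = 1 := by
    rw [jacobiSym.mod_left]
    have e : (4 * ((k + 1 : ℕ) : ℤ)) = 1 + ((4 * k + 3 : ℕ) : ℤ) * 1 := by push_cast; ring
    rw [e, Int.add_mul_emod_self_left, Int.emod_eq_of_lt (by norm_num) (by push_cast; omega)]
    exact jacobiSym.one_left _
  have hm1 : J(((k + 1 : ℕ) : ℤ) | 4 * k + 3) = 1 := by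
    rw [jacobiSym.mul_left, h4, one_mul] at hprod
    exact hprod
  rw [neg_eq_neg_one_mul, jacobiSym.mul_left, jacobiSym.at_neg_one hodd, hm1, mul_one]
  exact ZMod.χ₄_nat_three_mod_four (by omega)

/-- **A negative integer is a non-square modulo infinitely many primes.** For `D < 0` and every
`N` there is a prime `ℓ > N` with `D` not a square in `ℤ/ℓ`: by Dirichlet's theorem on primes in
arithmetic progressions (Mathlib `Nat.forall_exists_prime_gt_and_eq_mod`) there is a prime
`ℓ > N` with `ℓ ≡ -1 (mod 4|D|)`, and then `J(D | ℓ) = J(D | 4|D| - 1) = -1`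
(`jacobiSym.mod_right`, `jacobiSym_neg_natCast_eq_neg_one`). [folklore] -/
theorem exists_prime_gt_not_isSquare {D : ℤ} (hD : D < 0) (N : ℕ) :
    ∃ ℓ : ℕ, N < ℓ ∧ ℓ.Prime ∧ ¬ IsSquare (D : ZMod ℓ) := by
  obtain ⟨m, rfl⟩ := Int.exists_eq_neg_ofNat hD.le
  have hm : 0 < m := by omega
  set b : ℕ := 4 * m - 1 with hb
  have hb1 : b + 1 = 4 * m := by omega
  have hcop : Nat.Coprime b (4 * m) := by
    rw [← hb1]
    exact Nat.coprime_self_add_right.mpr (Nat.coprime_one_right b)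
  haveI : NeZero (4 * m) := ⟨by omega⟩
  have hu : IsUnit ((b : ℕ) : ZMod (4 * m)) := by
    rw [← ZMod.coe_unitOfCoprime b hcop]
    exact Units.isUnit _
  obtain ⟨ℓ, hℓN, hℓ, hℓb⟩ := Nat.forall_exists_prime_gt_and_eq_mod hu N
  refine ⟨ℓ, hℓN, hℓ, ZMod.nonsquare_of_jacobiSym_eq_neg_one ?_⟩
  have hmod : ℓ % (4 * m) = b := by
    have h := (ZMod.natCast_eq_natCast_iff' ℓ b (4 * m)).mp hℓb
    rwa [Nat.mod_eq_of_lt (show b < 4 * m by omega)] at h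
  have hℓodd : Odd ℓ := by
    refine Nat.odd_iff.mpr ?_
    rw [← Nat.mod_mod_of_dvd ℓ (show 2 ∣ 4 * m from ⟨2 * m, by ring⟩), hmod]
    omega
  have hnat : (-(m : ℤ)).natAbs = m := by
    rw [Int.natAbs_neg]
    rfl
  rw [jacobiSym.mod_right _ hℓodd, hnat, hmod]
  exact jacobiSym_neg_natCast_eq_neg_one hm

/-- If `a² - 4p` is not a square then `X² - aX + p` has no root (`4(x² - ax + p) =
(2x - a)² - (a² - 4p)`). [folklore] -/
theorem ne_zero_of_not_isSquare_discr {R : Type*} [CommRing R] {a p : R}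
    (h : ¬ IsSquare (a ^ 2 - 4 * p)) (x : R) : x ^ 2 - a * x + p ≠ 0 := by
  intro hx
  exact h ⟨2 * x - a, by linear_combination (-4 : R) * hx⟩

end Literature.NumberTheory.EllipticCurves.FrobeniusIrreducible

open Literature.NumberTheory.EllipticCurves.FrobeniusIrreducible

namespace WeierstrassCurve

/-! ## Irreducibility of `V_ℓ E` from one Frobenius (any base field) -/

section General

variable {K : Type u} [Field K] (W : WeierstrassCurve K) [W.IsElliptic] (ℓ : ℕ) [Fact ℓ.Prime]

/-- **A stable line forces integral eigenvalues.** Let `E` be an elliptic curve over a field `K`,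
`ℓ ≠ char K`, and `L ⊆ V_ℓ E` a `Γ_K`-stable `ℚ_ℓ`-line. Then for every `σ ∈ Γ_K` the
polynomial `X² - tr(σ | T_ℓ E) X + det(σ | T_ℓ E)` has a root in `ℤ_ℓ`: `L ∩ T_ℓ E = ℤ_ℓ v₀` for a
primitive `v₀` (`exists_primitive_of_stable_line`), so `σ v₀ = c v₀` with `c ∈ ℤ_ℓ`, and
Cayley–Hamilton (`Matrix.sq_eq_trace_smul_sub_det_fin_two` in a basis of `T_ℓ E ≅ ℤ_ℓ²`) gives
`(c² - tr c + det) v₀ = 0` with `v₀ ≠ 0`. [folklore] -/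
theorem exists_root_of_stable_line (hℓ : (ℓ : K) ≠ 0)
    (L : Submodule ℚ_[ℓ] (W.rationalTateModule ℓ))
    (hL : ∀ σ : absoluteGaloisGroup K, ∀ v ∈ L, W.rationalGaloisRepTate ℓ σ v ∈ L)
    (hL1 : Module.finrank ℚ_[ℓ] L = 1) (σ : absoluteGaloisGroup K) :
    ∃ c : ℤ_[ℓ], c * c - LinearMap.trace ℤ_[ℓ] _ (W.galoisRepTate ℓ σ) * c +
      LinearMap.det (W.galoisRepTate ℓ σ) = 0 := by
  classical
  obtain ⟨v₀, hv₀, hv₀L, hint, -⟩ := exists_primitive_of_stable_line ℓ hℓ L hL hL1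
  have hv₀0 : v₀ ≠ 0 := fun h ↦ hv₀ (by rw [h, map_zero])
  -- `σ • v₀ ∈ T ∩ L = ℤ_ℓ v₀`
  have hσ : TateModule.toRational ℓ (σ • v₀) ∈ L := by
    rw [← rationalTateRepresentation_toRational]
    exact hL σ _ hv₀L
  obtain ⟨c, hc⟩ := hint _ hσ
  refine ⟨c, ?_⟩
  haveI := module_free_tateModule_holds W ℓ
  haveI := module_finite_tateModule_holds W ℓ
  set f : Module.End ℤ_[ℓ] (W.tateModule ℓ) := W.galoisRepTate ℓ σ with hf
  have hfv : f v₀ = c • v₀ := by rw [hf, galoisRepTate_apply_apply, hc]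
  -- Cayley–Hamilton in a basis of `T_ℓ E ≅ ℤ_ℓ²`
  let b := Module.finBasisOfFinrankEq ℤ_[ℓ] (W.tateModule ℓ)
    (finrank_tateModule_eq_two_holds W ℓ hℓ)
  set A : Matrix (Fin 2) (Fin 2) ℤ_[ℓ] := LinearMap.toMatrix b b f with hA
  have hCH : f * f = A.trace • f - A.det • (1 : Module.End ℤ_[ℓ] (W.tateModule ℓ)) := by
    apply (LinearMap.toMatrix b b).injective
    rw [LinearMap.toMatrix_mul, map_sub, map_smul, map_smul, LinearMap.toMatrix_one, ← hA,
      ← sq]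
    exact Matrix.sq_eq_trace_smul_sub_det_fin_two A
  have htr : LinearMap.trace ℤ_[ℓ] _ f = A.trace := LinearMap.trace_eq_matrix_trace ℤ_[ℓ] b f
  have hdet : LinearMap.det f = A.det := (LinearMap.det_toMatrix b f).symm
  have h1 : (c * c - A.trace * c + A.det) • v₀ = f (f v₀) - (A.trace • f - A.det • 1) v₀ := by
    simp only [LinearMap.sub_apply, LinearMap.smul_apply, Module.End.one_apply, hfv, map_smul]
    module
  have h2 : f (f v₀) - (A.trace • f - A.det • 1) v₀ = 0 := by
    rw [← Module.End.mul_apply, hCH, sub_self]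
  rw [h2] at h1
  rw [htr, hdet]
  exact (smul_eq_zero.mp h1).resolve_right hv₀0

/-- **No stable line when one characteristic polynomial is irreducible modulo `ℓ`.** With
notation as in `exists_root_of_stable_line`: if for some `σ ∈ Γ_K` the reduction modulo `ℓ` of
`X² - tr(σ) X + det(σ)` has no root in `𝔽_ℓ`, then `V_ℓ E` has no `Γ_K`-stable line (a root in
`ℤ_ℓ` would reduce to a root in `𝔽_ℓ`). [folklore] -/
theorem finrank_ne_one_of_stable_of_no_root (hℓ : (ℓ : K) ≠ 0) {σ : absoluteGaloisGroup K}
    (hσ : ∀ x : ZMod ℓ, x ^ 2 - PadicInt.toZMod (LinearMap.trace ℤ_[ℓ] _ (W.galoisRepTate ℓ σ)) * x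
      + PadicInt.toZMod (LinearMap.det (W.galoisRepTate ℓ σ)) ≠ 0)
    (L : Submodule ℚ_[ℓ] (W.rationalTateModule ℓ))
    (hL : ∀ τ : absoluteGaloisGroup K, ∀ v ∈ L, W.rationalGaloisRepTate ℓ τ v ∈ L) :
    Module.finrank ℚ_[ℓ] L ≠ 1 := by
  intro hL1
  obtain ⟨c, hc⟩ := exists_root_of_stable_line W ℓ hℓ L hL hL1 σ
  apply hσ (PadicInt.toZMod c)
  have h := congrArg (PadicInt.toZMod (p := ℓ)) hc
  rw [map_add, map_sub, map_mul, map_mul, map_zero] at h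
  rw [sq]
  exact h

/-- **Irreducibility of `V_ℓ E` from the absence of stable lines.** For `E` elliptic over `K`
and `ℓ ≠ char K`, `dim V_ℓ E = 2` (`finrank_rationalTateModule_eq_two_holds`), so if no
`Γ_K`-stable `ℚ_ℓ`-subspace has dimension `1` then every subrepresentation of `V_ℓ E` is `0` or
`V_ℓ E`: the representation is irreducible (Mathlib `Representation.IsIrreducible`). [folklore] -/
theorem isIrreducible_rationalGaloisRepTate_of_finrank_ne_one (hℓ : (ℓ : K) ≠ 0)
    (h : ∀ L : Submodule ℚ_[ℓ] (W.rationalTateModule ℓ),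
      (∀ σ : absoluteGaloisGroup K, ∀ v ∈ L, W.rationalGaloisRepTate ℓ σ v ∈ L) →
      Module.finrank ℚ_[ℓ] L ≠ 1) :
    (W.rationalGaloisRepTate ℓ).IsIrreducible := by
  have h2 := finrank_rationalTateModule_eq_two_holds W ℓ hℓ
  haveI : FiniteDimensional ℚ_[ℓ] (W.rationalTateModule ℓ) := Module.finite_of_finrank_eq_succ h2
  haveI : Nontrivial (W.rationalTateModule ℓ) :=
    Module.nontrivial_of_finrank_pos (R := ℚ_[ℓ]) (by omega)
  haveI : Nontrivial (Subrepresentation (W.rationalGaloisRepTate ℓ)) :=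
    ⟨⊥, ⊤, fun hbt ↦ bot_ne_top (congrArg Subrepresentation.toSubmodule hbt)⟩
  refine { eq_bot_or_eq_top := fun N ↦ ?_ }
  have hle : Module.finrank ℚ_[ℓ] N.toSubmodule ≤ 2 := h2 ▸ Submodule.finrank_le N.toSubmodule
  have hne : Module.finrank ℚ_[ℓ] N.toSubmodule ≠ 1 :=
    h N.toSubmodule fun σ v hv ↦ N.apply_mem_toSubmodule σ hv
  rcases (by omega : Module.finrank ℚ_[ℓ] N.toSubmodule = 0 ∨
      Module.finrank ℚ_[ℓ] N.toSubmodule = 2) with h0 | h2'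
  · exact Or.inl (Subrepresentation.toSubmodule_injective (Submodule.finrank_eq_zero.mp h0))
  · exact Or.inr (Subrepresentation.toSubmodule_injective
      (Submodule.eq_top_of_finrank_eq (h2'.trans h2.symm)))

end General

/-! ## Over a number field: a Frobenius with irreducible characteristic polynomial modulo `ℓ` -/

section NumberField

variable {K : Type u} [Field K] [NumberField K] (W : WeierstrassCurve K) [W.IsElliptic]
  (ℓ : ℕ) [Fact ℓ.Prime]

/-- **`V_ℓ E` is irreducible if some Frobenius has irreducible characteristic polynomial modulo
`ℓ`.** Let `E` be an elliptic curve over a number field `K`, `ℓ` a prime, `v ∤ ℓ` a finite place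
of good reduction with residue field of `q_v` elements and trace of Frobenius `a_v`
(`W.frobeniusTraceAt v`). If `X² - a_v X + q_v` has no root modulo `ℓ`, then `V_ℓ E` is an
irreducible `ℚ_ℓ[Γ_K]`-module: an arithmetic Frobenius `σ` at a prime over `v`
(`exists_isArithFrobAt_of_mem_primesAbove_holds`) has `tr(σ | T_ℓ E) = a_v` and
`det(σ | T_ℓ E) = q_v` (Silverman, *AEC*, C.21 Remark 21.3;
`trace/det_galoisRepTate_frobenius_of_hasGoodReductionAt_holds`), and
`finrank_ne_one_of_stable_of_no_root` applies. (Cf. Serre (1968), IV.2.1–2.2.)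
[cite: SilvermanAEC2009, C.21 Remark 21.3] -/
theorem isIrreducible_rationalGaloisRepTate_of_frobenius {v : HeightOneSpectrum (𝓞 K)}
    (hℓv : (ℓ : 𝓞 K) ∉ v.asIdeal) (hv : W.HasGoodReductionAt v)
    (hirr : ∀ x : ZMod ℓ, x ^ 2 - (W.frobeniusTraceAt v : ZMod ℓ) * x +
      (Nat.card (IsLocalRing.ResidueField (v.adicCompletionIntegers K)) : ZMod ℓ) ≠ 0) :
    (W.rationalGaloisRepTate ℓ).IsIrreducible := by
  have hℓK : (ℓ : K) ≠ 0 := Nat.cast_ne_zero.mpr (Fact.out : ℓ.Prime).ne_zero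
  obtain ⟨𝔓, h𝔓⟩ := HeightOneSpectrum.primesAbove_nonempty v
  obtain ⟨σ, hσ⟩ := HeightOneSpectrum.exists_isArithFrobAt_of_mem_primesAbove_holds h𝔓
  refine isIrreducible_rationalGaloisRepTate_of_finrank_ne_one W ℓ hℓK
    (finrank_ne_one_of_stable_of_no_root W ℓ hℓK (σ := σ) fun x ↦ ?_)
  rw [trace_galoisRepTate_frobenius_of_hasGoodReductionAt_holds W ℓ v hℓv hv h𝔓 hσ,
    det_galoisRepTate_frobenius_of_hasGoodReductionAt_holds W ℓ v hℓv hv h𝔓 hσ, map_intCast,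
    map_natCast]
  exact hirr x

end NumberField

/-! ## Over `ℚ`: Hasse's bound and the auxiliary primes `ℓ` -/

section Rat

open Rat.HeightOneSpectrum

/-- **Hasse's bound for `a_v`, strict form over `ℚ`.** For an elliptic curve `E / ℚ` and a
finite place `v` of good reduction over the prime `p`, the trace of Frobenius
`a_v = p + 1 - #Ẽ_v(𝔽_p)` satisfies `a_v² < 4p`: `|a_v| ≤ 2√p` is Hasse's theorem for the
elliptic curve `Ẽ_v / 𝔽_p` (Silverman, *AEC*, Thm. V.1.1; the tree's
`HasseManin.abs_card_sub_le`, Manin's proof), and `a_v² = 4p` is impossible because `p` is not a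
square. [cite: SilvermanAEC2009, Thm. V.1.1] -/
theorem frobeniusTraceAt_sq_lt_four_mul (W : WeierstrassCurve ℚ) [W.IsElliptic]
    {v : HeightOneSpectrum (𝓞 ℚ)} (hv : W.HasGoodReductionAt v) :
    W.frobeniusTraceAt v ^ 2 < 4 * ((primesEquiv v : ℕ) : ℤ) := by
  set k := IsLocalRing.ResidueField (v.adicCompletionIntegers ℚ) with hkdef
  have hp : (primesEquiv v : ℕ).Prime := (primesEquiv v).2
  have hk : Nat.card k = (primesEquiv v : ℕ) := natCard_residueField_adicCompletionIntegers v
  haveI : Finite k := Nat.finite_of_card_ne_zero (by rw [hk]; exact hp.ne_zero)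
  letI : Fintype k := Fintype.ofFinite k
  haveI : (W.reductionAt v).IsElliptic := isElliptic_reductionAt hv
  have hF : (Fintype.card k : ℝ) = (primesEquiv v : ℕ) := by
    rw [← Nat.card_eq_fintype_card (α := k), hk]
  have hH := Literature.NumberTheory.EllipticCurves.HasseManin.abs_card_sub_le (W.reductionAt v)
  set a : ℤ := W.frobeniusTraceAt v with ha
  have haR : (a : ℝ) = ((Fintype.card k : ℝ) + 1) -
      (Nat.card (W.reductionAt v).toAffine.Point : ℝ) := by
    rw [ha, frobeniusTraceAt_def, ← Nat.card_eq_fintype_card (α := k)]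
    push_cast
    ring
  have habs : |(a : ℝ)| ≤ 2 * Real.sqrt (primesEquiv v : ℕ) := by
    rw [haR, abs_sub_comm, ← hF]
    exact hH
  have h0 : (0 : ℝ) ≤ (primesEquiv v : ℕ) := Nat.cast_nonneg _
  have hsqR : ((a ^ 2 : ℤ) : ℝ) ≤ ((4 * ((primesEquiv v : ℕ) : ℤ) : ℤ) : ℝ) := by
    push_cast
    have h1 : (a : ℝ) ^ 2 ≤ (2 * Real.sqrt (primesEquiv v : ℕ)) ^ 2 := by
      rw [← sq_abs (a : ℝ)]
      exact pow_le_pow_left₀ (abs_nonneg _) habs 2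
    calc (a : ℝ) ^ 2 ≤ (2 * Real.sqrt (primesEquiv v : ℕ)) ^ 2 := h1
      _ = 4 * (primesEquiv v : ℕ) := by rw [mul_pow, Real.sq_sqrt h0]; norm_num
  have hle : a ^ 2 ≤ 4 * ((primesEquiv v : ℕ) : ℤ) := by exact_mod_cast hsqR
  refine lt_of_le_of_ne hle fun heq ↦ ?_
  -- `a² = 4p` would make `p` a square
  have h2 : (2 : ℤ) ∣ a := by
    have h : (2 : ℤ) ∣ a ^ 2 := ⟨2 * (primesEquiv v : ℕ), by rw [heq]; ring⟩
    exact Int.prime_two.dvd_of_dvd_pow h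
  obtain ⟨c, hc⟩ := h2
  have hcc : c * c = ((primesEquiv v : ℕ) : ℤ) := by
    have h : (4 : ℤ) * (c * c) = 4 * ((primesEquiv v : ℕ) : ℤ) := by rw [← heq, hc]; ring
    exact mul_left_cancel₀ (by norm_num) h
  exact (Nat.prime_iff_prime_int.mp hp).not_isSquare ⟨c, hcc.symm⟩

/-- **The auxiliary primes.** Let `v` be a finite place of `ℚ` over `p` and `a` an integer with
`a² < 4p`. For every `N` there is a prime `ℓ > N`, `ℓ ≠ p`, such that `V_ℓ E` is an irreducible
`ℚ_ℓ[Γ_ℚ]`-module for **every** elliptic curve `E / ℚ` with good reduction at `v` and `a_v = a`: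
take `ℓ` with `a² - 4p` a non-square modulo `ℓ` (`exists_prime_gt_not_isSquare`), so that
`X² - aX + p` has no root modulo `ℓ` (`ne_zero_of_not_isSquare_discr`), and apply
`isIrreducible_rationalGaloisRepTate_of_frobenius`. [folklore] -/
theorem exists_prime_gt_forall_isIrreducible (v : HeightOneSpectrum (𝓞 ℚ)) {a : ℤ}
    (ha : a ^ 2 < 4 * ((primesEquiv v : ℕ) : ℤ)) (N : ℕ) :
    ∃ (ℓ : ℕ) (_ : Fact ℓ.Prime), N < ℓ ∧ (primesEquiv v : ℕ) ≠ ℓ ∧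
      ∀ (W : WeierstrassCurve ℚ) [W.IsElliptic], W.HasGoodReductionAt v →
        W.frobeniusTraceAt v = a → (W.rationalGaloisRepTate ℓ).IsIrreducible := by
  set p : ℕ := (primesEquiv v : ℕ) with hpdef
  have hD : a ^ 2 - 4 * (p : ℤ) < 0 := by linarith
  obtain ⟨ℓ, hℓN, hℓ, hsq⟩ := exists_prime_gt_not_isSquare hD (max N p)
  have hNℓ : N < ℓ := lt_of_le_of_lt (le_max_left _ _) hℓN
  have hpℓ : p ≠ ℓ := (lt_of_le_of_lt (le_max_right N p) hℓN).ne
  refine ⟨ℓ, ⟨hℓ⟩, hNℓ, hpℓ, fun W _ hv hav ↦ ?_⟩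
  haveI := Fact.mk hℓ
  refine isIrreducible_rationalGaloisRepTate_of_frobenius W ℓ
    (natCast_not_mem_asIdeal_of_primesEquiv_ne hℓ hpℓ) hv fun x ↦ ?_
  rw [natCard_residueField_adicCompletionIntegers v, hav]
  refine ne_zero_of_not_isSquare_discr ?_ x
  push_cast at hsq
  exact hsq

/-- **`V_ℓ E` is irreducible for infinitely many `ℓ`, unconditionally.** For an elliptic curve
`E / ℚ` and every `N` there is a prime `ℓ > N` such that the `ℚ_ℓ[Γ_ℚ]`-module `V_ℓ E` is
irreducible: choose a prime `p` of good reduction (`finite_badPlaces_holds`), use Hasse's bound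
`a_p² < 4p` (`frobeniusTraceAt_sq_lt_four_mul`) and `exists_prime_gt_forall_isIrreducible`.
[folklore] -/
theorem exists_prime_gt_isIrreducible_rationalGaloisRepTate (W : WeierstrassCurve ℚ)
    [W.IsElliptic] (N : ℕ) :
    ∃ (ℓ : ℕ) (_ : Fact ℓ.Prime), N < ℓ ∧ (W.rationalGaloisRepTate ℓ).IsIrreducible := by
  -- a prime of good reduction
  have hbad : ((fun v : HeightOneSpectrum (𝓞 ℚ) ↦ (primesEquiv v : ℕ)) ''
      W.badPlaces (𝓞 ℚ)).Finite := (finite_badPlaces_holds (𝓞 ℚ) W).image _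
  obtain ⟨p, hp, hpS⟩ := (Nat.infinite_setOf_prime.sdiff hbad).nonempty
  obtain ⟨v, rfl⟩ : ∃ v : HeightOneSpectrum (𝓞 ℚ), (primesEquiv v : ℕ) = p :=
    ⟨primesEquiv.symm ⟨p, hp⟩, by rw [Equiv.apply_symm_apply]⟩
  have hgood : W.HasGoodReductionAt v := by
    by_contra hb
    exact hpS ⟨v, (mem_badPlaces_iff W v).mpr hb, rfl⟩
  obtain ⟨ℓ, hℓ, hNℓ, -, hirr⟩ :=
    exists_prime_gt_forall_isIrreducible v (W.frobeniusTraceAt_sq_lt_four_mul hgood) N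
  exact ⟨ℓ, hℓ, hNℓ, hirr W hgood rfl⟩

end Rat

end WeierstrassCurve
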